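import Summits.BirchSwinnertonDyer.BirchSwinnertonDyer.Theorems.TwinTransportX9Assembly
import HarnessLib

/-!
# Route `TwinTransportX9` — glue item `AssemblyViaRankZero`, kernel-checked

`Summit.BirchSwinnertonDyer.BirchSwinnertonDyer.Theses.TwinTransportX9.AssemblyViaRankZero` :=
`TwistDefectBalanceX9 → TrivialTwinSupplyX9 → RankZeroBSDpToIMCX9 → TamagawaResidualIMCX9 →
PublishedInputsX9 → IntegralMainConjectureOnClassX9` is PROVED — the route's Assembly with the zero-defect
step at the twin supplied by `RankZeroBSDpToIMCX9` (proved from named facts in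
`Theorems/TwinTransportX9RankZero.lean`) instead of the fact-free `TwinDefectZeroX9`; the transport is
`TwinTransport.defect_eq_zero_of_step` of `Theorems/TwinTransportX9Assembly.lean`.  A trivial twin
(`p ∤ Tam`, `v_p(L/Ω) = 0`) satisfies the Tamagawa-normalised twin predicate because `padicValNat p Tam = 0`.

THEOREMS ONLY (no definition, no named fact, no `sorry`); nothing booked — balance, supply, residual and the
published inputs are hypotheses; no summit or leaf is proved (ideator seat bsd-idea-2 g2).
-/

set_option linter.dupNamespace false
set_option autoImplicit false

noncomputable section

open scoped Classical

open WeierstrassCurve Literature.NumberTheory.EllipticCurves Literature.NumberTheory.EllipticCurves.ModularForms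
  Summit.BirchSwinnertonDyer.BirchSwinnertonDyer.Rank1Residual

open Summit.BirchSwinnertonDyer.BirchSwinnertonDyer.Theses.TwinTransportX9
  (TwistDefectBalanceX9 TrivialTwinSupplyX9 TamagawaResidualIMCX9 PublishedInputsX9 RankZeroBSDpToIMCX9
    AssemblyViaRankZero)

namespace Summit.BirchSwinnertonDyer.BirchSwinnertonDyer.Rank1Residual

namespace TwinTransport

/-! ### The Assembly via `RankZeroBSDpToIMCX9` -/

/-- **The route's `AssemblyViaRankZero` item, proved**: transport to a trivial twin (`p ∤ Tam`), the
zero-defect step at the twin supplied by `RankZeroBSDpToIMCX9` (a trivial twin satisfies the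
Tamagawa-normalised twin predicate since `padicValNat p Tam = 0`); residual imported (`p ∣ Tam`). -/
theorem twinTransportX9_assemblyViaRankZero : AssemblyViaRankZero := by
  intro hBal hTwin hR0 hTam hPub W _ _ p _ κ γ N _ f hX9 hκ hγ hγ' hf D
  obtain ⟨hBCSa, hGr, hPer, -, -, hmodP, hmodL, hGZK⟩ := hPub
  by_cases hTamDiv : p ∣ W.tamagawaProduct
  · exact hTam W p κ γ f hX9 hTamDiv hκ hγ hγ' hf D
  have hZero := hR0 hBCSa hGr hPer hmodP hmodL hGZK
  obtain ⟨hX, g, k, hchar, hιg⟩ :=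
    hBCSa W p κ γ f hX9.2.1 hX9.2.2.1 hX9.2.2.2.1 hX9.2.2.2.2.1 hκ hγ hγ' hf D
  suffices hk : k = 0 by
    subst hk
    exact ⟨hX, g, hchar, by simpa using hιg⟩
  have hmod : exists_isNewformOf := exists_isNewformOf_of_nonempty_modularParametrizationData hmodP
  obtain ⟨dK, dF, hadm, W₁, i₁, i₁', ⟨C, hC⟩, hcase⟩ := hTwin W p hX9 hTamDiv
  haveI := i₁; haveI := i₁'
  have hX9₁ : ClassX9 W₁ p :=
    Summit.BirchSwinnertonDyer.Rank1Residual.X9.classX9_of_smul_eq_quadraticTwist W W₁ p hX9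
      hadm.1.2.1 hC hadm.2.2.1.1
  haveI : NeZero (W₁.conductorNorm ℤ) := ⟨(W₁.conductorNorm_pos_holds).ne'⟩
  obtain ⟨f₁, hf₁⟩ := hmod W₁
  obtain ⟨D₁⟩ := W₁.nonempty_selmerDualData_holds κ γ hγ
  rcases hcase with htwin | ⟨dK', dF', hadm', W₂, i₂, i₂', ⟨C₂, hC₂⟩, htwin₂⟩
  · obtain ⟨hr₁, hS₁, hT₁, htor₁, q₁, hq₁, hv₁⟩ := htwin
    have htwin' : W₁.analyticRank = 0 ∧ ¬ p ∣ W₁.shaOrder ∧ ¬ p ∣ W₁.torsionOrder ∧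
        ∃ q : ℚ, W₁.leadingLCoeff / (W₁.realPeriodRat : ℂ) = (q : ℂ) ∧
          padicValRat p q = (padicValNat p W₁.tamagawaProduct : ℤ) :=
      ⟨hr₁, hS₁, htor₁, q₁, hq₁, by rw [hv₁, padicValNat.eq_zero_of_not_dvd hT₁]; simp⟩
    obtain ⟨-, g₁, hchar₁, hιg₁⟩ := hZero W₁ p hX9₁ htwin' κ γ f₁ hκ hγ hγ' hf₁ D₁
    exact defect_eq_zero_of_step hBal W p hX9 hadm W₁ ⟨C, hC⟩ κ γ f f₁ hκ hγ hγ' hf hf₁ D D₁ g g₁ k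
      hchar hιg hchar₁ hιg₁
  · haveI := i₂; haveI := i₂'
    have hX9₂ : ClassX9 W₂ p :=
      Summit.BirchSwinnertonDyer.Rank1Residual.X9.classX9_of_smul_eq_quadraticTwist W₁ W₂ p hX9₁
        hadm'.1.2.1 hC₂ hadm'.2.2.1.1
    haveI : NeZero (W₂.conductorNorm ℤ) := ⟨(W₂.conductorNorm_pos_holds).ne'⟩
    obtain ⟨f₂, hf₂⟩ := hmod W₂
    obtain ⟨D₂⟩ := W₂.nonempty_selmerDualData_holds κ γ hγ
    obtain ⟨-, g₁, k₁, hchar₁, hιg₁⟩ :=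
      hBCSa W₁ p κ γ f₁ hX9₁.2.1 hX9₁.2.2.1 hX9₁.2.2.2.1 hX9₁.2.2.2.2.1 hκ hγ hγ' hf₁ D₁
    obtain ⟨hr₂, hS₂, hT₂, htor₂, q₂, hq₂, hv₂⟩ := htwin₂
    have htwin₂' : W₂.analyticRank = 0 ∧ ¬ p ∣ W₂.shaOrder ∧ ¬ p ∣ W₂.torsionOrder ∧
        ∃ q : ℚ, W₂.leadingLCoeff / (W₂.realPeriodRat : ℂ) = (q : ℂ) ∧
          padicValRat p q = (padicValNat p W₂.tamagawaProduct : ℤ) :=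
      ⟨hr₂, hS₂, htor₂, q₂, hq₂, by rw [hv₂, padicValNat.eq_zero_of_not_dvd hT₂]; simp⟩
    obtain ⟨-, g₂, hchar₂, hιg₂⟩ := hZero W₂ p hX9₂ htwin₂' κ γ f₂ hκ hγ hγ' hf₂ D₂
    have hk₁ : k₁ = 0 :=
      defect_eq_zero_of_step hBal W₁ p hX9₁ hadm' W₂ ⟨C₂, hC₂⟩ κ γ f₁ f₂ hκ hγ hγ' hf₁ hf₂ D₁ D₂
        g₁ g₂ k₁ hchar₁ hιg₁ hchar₂ hιg₂
    subst hk₁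
    exact defect_eq_zero_of_step hBal W p hX9 hadm W₁ ⟨C, hC⟩ κ γ f f₁ hκ hγ hγ' hf hf₁ D D₁ g g₁ k
      hchar hιg hchar₁ (by simpa using hιg₁)

/-- The route item, by its fully qualified name. -/
theorem assemblyViaRankZero_holds :
    Summit.BirchSwinnertonDyer.BirchSwinnertonDyer.Theses.TwinTransportX9.AssemblyViaRankZero :=
  twinTransportX9_assemblyViaRankZero

end TwinTransport

end Summit.BirchSwinnertonDyer.BirchSwinnertonDyer.Rank1Residual

end
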